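import Summits.BirchSwinnertonDyer.Rank1Residual.X1.TamagawaSqueeze
import Summits.BirchSwinnertonDyer.Rank1Residual.X1.MuPart
import Literature.NumberTheory.EllipticCurves.QuadraticTwist
import Literature.NumberTheory.EllipticCurves.Rank1Residual.ClassX1
import Literature.NumberTheory.EllipticCurves.ZpExtension
import Mathlib.NumberTheory.NumberField.ClassNumber
import HarnessLib

/-!
# bsd-eis-idea g23 — PARITY-MIXING / REFLECTION lens memo, typed by-products
(crux `stmt-BirchSwinnertonDyer-19035`, decl
`Summit.BirchSwinnertonDyer.BirchSwinnertonDyer.Theses.EisensteinPrimes.MazurMCOnX1RankZero`)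

This seat files NO crux idea card (the reflection / parity-mixing lens reduces to the cone: see
`Ideas/reflection-g23-lens-memo.md`). Typed here, all `def … : Prop`, no axioms, no `sorry`:

* `TwistedClassGroupLambdaWitnessRank p` (**R1**, theorem-grade, folklore from Greenberg, LNM 1716,
  proof of Prop. 5.10 + Prop. 4.15): on a TWISTED type-A class — `Wd ≅ W'^{(d_F)}` with `p ∣ #W'(ℚ)_tors`,
  `F` real quadratic, `Wd` in X1 of analytic rank 0 with certified analytic `μ = 0` — an elementary
  abelian `p`-subgroup of rank `r` of `Cl(F)` forces `λ_alg(Wd) ≥ r`: the classes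
  `Hom(X(F_∞)^{ε_F}, 𝔽_p(ε_F)) ↪ Sel_{p^∞}(Wd/ℚ_∞)[p]` are everywhere locally trivial over `ℚ_∞`
  (residue fields of `ℚ_∞` at `η ∤ p` have pro-prime-to-`p` Galois group; at `π ∣ p`,
  `H¹_unr(ℚ_{∞,π}, Ẽ[p^∞]) = 0` since `Frob − 1` is surjective on a divisible group), and `μ = 0`
  + no finite `Λ`-submodule turn `p`-torsion classes into `ℤ_p`-rank.
* `TwistedClassGroupLambdaWitness p` — the `r = 1` reading (`p ∣ h(F)` ⇒ `λ_alg ≥ 1`).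
* `GreenbergPlusLambdaLEAnalyticLambda p` (**R3**, export remark): the same injection read the other
  way with Kato's bound: the Iwasawa `λ` of the cyclotomic tower of the real quadratic field `F` is at
  most the certified analytic `λ` of `Wd` (a modular-symbol criterion towards Greenberg's `λ = 0`
  conjecture; weak: `λ_an ≥ 2` on every twisted anomalous class).

Desk falsifier F-g23-1 (`Ideas/reflection-g23-falsifier.md`): on ALL 1091 twisted X1 rank-0 classes
with `N < 5·10⁵` (p = 3: 927, 5: 119, 7: 37, 13: 8) the quadratic field `F` has `p ∤ h(F)` — by
necessity (`d_F² ∣ N` forces `d_F ≤ 189 < 229 =` the least real quadratic discriminant with `3 ∣ h`),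
so R1 is VACUOUS on the certified range; first classes where it can bite: `W'^{(229)}`, `N = 229²·N'`
(`14a`: `N = 734 174`). Route-T consistency re-check on the same 1091 classes: `λ_an ≥ S_T + 2` holds
1091/1091 (margin 0 in 646).
-/

namespace Summit.BirchSwinnertonDyer.BirchSwinnertonDyer.Cruxes.MazurMCOnX1RankZero.ReflectionG23

open Literature.NumberTheory.EllipticCurves Literature.NumberTheory.EllipticCurves.Rank1Residual
open Summit.BirchSwinnertonDyer.Rank1Residual
open scoped NumberField

/-- **R1 (rank form).** Twisted type-A class-group witness for the algebraic λ-invariant: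
`Wd ≅ W'^{(d_F)}`, `p ∣ #W'(ℚ)_tors` (so `Wd[p]^{ss} = ε_F ⊕ ω ε_F`, `ε_F` even, i.e. `F` real),
`Wd ∈ X1`, `r_an(Wd) = 0`, analytic `μ(Wd) = 0`; an injection `(ℤ/p)^r ↪ Cl(F)` gives `λ_alg(Wd) ≥ r`.
[cite: Greenberg1999LNM1716, §5: Lemma 5.9, proof of Prop. 5.10 and the remark after it (corpus book:coates1999-arithmetic-theory-elliptic-curves chunks p0142–p0149), Prop. 4.15; folklore] -/
def TwistedClassGroupLambdaWitnessRank (p : ℕ) [Fact p.Prime] : Prop :=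
  ∀ (W' Wd : WeierstrassCurve ℚ) [W'.IsElliptic] [Wd.IsElliptic] [Wd.IsGloballyMinimal]
    (F : Type) [Field F] [NumberField F] (r : ℕ),
    2 < p → p ∣ W'.torsionOrder → Module.finrank ℚ F = 2 → 0 < NumberField.discr F →
    (∃ C : WeierstrassCurve.VariableChange ℚ, C • Wd = W'.quadraticTwist (NumberField.discr F : ℚ)) →
    ClassX1 Wd p → Wd.analyticRank = 0 → X1.MuPart.AnalyticMuLE Wd p 0 →
    (∃ f : (Fin r → ZMod p) →+ Additive (ClassGroup (𝓞 F)), Function.Injective f) →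
    X1.TamagawaSqueeze.AlgebraicLambdaGE Wd p r

/-- **R1 (divisibility form, `r = 1`).** Same hypotheses; `p ∣ h(F)` gives `λ_alg(Wd) ≥ 1`.
(Dominated on the census range by route T's `λ_alg ≥ S_T + 2`; typed for the record.)
[cite: Greenberg1999LNM1716, proof of Prop. 5.10; folklore] -/
def TwistedClassGroupLambdaWitness (p : ℕ) [Fact p.Prime] : Prop :=
  ∀ (W' Wd : WeierstrassCurve ℚ) [W'.IsElliptic] [Wd.IsElliptic] [Wd.IsGloballyMinimal]
    (F : Type) [Field F] [NumberField F],
    2 < p → p ∣ W'.torsionOrder → Module.finrank ℚ F = 2 → 0 < NumberField.discr F →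
    (∃ C : WeierstrassCurve.VariableChange ℚ, C • Wd = W'.quadraticTwist (NumberField.discr F : ℚ)) →
    ClassX1 Wd p → Wd.analyticRank = 0 → X1.MuPart.AnalyticMuLE Wd p 0 →
    p ∣ NumberField.classNumber F →
    X1.TamagawaSqueeze.AlgebraicLambdaGE Wd p 1

/-- **R3 (export remark, Greenberg-conjecture criterion).** Same twisted type-A setting with certified
analytic `λ(Wd) = n`: along the cyclotomic `ℤ_p`-extension of the real quadratic field `F` the
`p`-parts of the class numbers grow at most like `p^{n·m + c}` — i.e. `λ(X(F_∞)) ≤ n`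
(`λ(X(F_∞)) ≤ rk_p X(F_∞) ≤ λ_alg(Wd) ≤ λ_an(Wd)`, the last step Kato's divisibility).
[cite: Greenberg1999LNM1716, proof of Prop. 5.10; Kato2004, Thm. 17.4; folklore] -/
def GreenbergPlusLambdaLEAnalyticLambda (p : ℕ) [Fact p.Prime] : Prop :=
  ∀ (W' Wd : WeierstrassCurve ℚ) [W'.IsElliptic] [Wd.IsElliptic] [Wd.IsGloballyMinimal]
    (F : Type) [Field F] [NumberField F] (n : ℕ),
    2 < p → p ∣ W'.torsionOrder → Module.finrank ℚ F = 2 → 0 < NumberField.discr F →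
    (∃ C : WeierstrassCurve.VariableChange ℚ, C • Wd = W'.quadraticTwist (NumberField.discr F : ℚ)) →
    ClassX1 Wd p → Wd.analyticRank = 0 → X1.MuPart.AnalyticMuLE Wd p 0 →
    X1.ParitySqueeze.AnalyticLambdaEq Wd p n →
    ∀ (κ : ZpExtension F p), κ.IsCyclotomic →
      ∃ c : ℕ, ∀ (m : ℕ) [NumberField (κ.layer m)],
        padicValNat p (NumberField.classNumber (κ.layer m)) ≤ n * m + c

/-- Sanity: the rank form at `r = 1` gives the divisibility form (an element of order `p` in
`Cl(F)` from `p ∣ h(F)` by Cauchy). Stated as a `Prop` implication to be discharged by a prover;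
NOT proved here (this file carries no proofs). -/
def RankFormImpliesDivisibilityForm (p : ℕ) [Fact p.Prime] : Prop :=
  TwistedClassGroupLambdaWitnessRank p → TwistedClassGroupLambdaWitness p

end Summit.BirchSwinnertonDyer.BirchSwinnertonDyer.Cruxes.MazurMCOnX1RankZero.ReflectionG23
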